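import Summits.QuantumFields.YangMills.Theorems.ForcedResponseSkewnessFemtoEngineDefs
import Summits.QuantumFields.YangMills.Theorems.ForcedResponseSkewnessAssembly
import Summits.QuantumFields.YangMills.Theorems.ForcedResponseSkewnessFemtoOfFBL6
import Summits.QuantumFields.YangMills.Theorems.ForcedResponseSkewnessResponseLocalisationStubSymContactOfFemto
import Summits.QuantumFields.YangMills.Theorems.ForcedResponseSkewnessResponseLocalisationStubSignedOfSymKernel
import Summits.QuantumFields.YangMills.Theorems.ForcedResponseSkewnessResponseLocalisationSymNearCovOfCentredOsc
import Summits.QuantumFields.YangMills.Theorems.ForcedResponseSkewnessRunningCouplingCeilingOfFBL6FemtoLog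
import Summits.QuantumFields.YangMills.Theorems.ForcedResponseSkewnessRunningCouplingCeilingFemtoLogOfCentred
import Summits.QuantumFields.YangMills.Theorems.BalabanLadderNTBoundaryLawOscillation
import HarnessLib

/-!
# Route `ForcedResponseSkewness`: the FEMTO ENGINE INTERFACE closes both cruxes, and with the residual the leaf `NT`

Helper file of the lead `ym-line-frs-p1` (g6), `--supports stmt-QuantumFields-26871` (vocabulary:
`Theorems/ForcedResponseSkewnessFemtoEngineDefs.lean`).  The kernel-checked CERTIFICATE of the route's status after the
g2–g5 analysis: everything outside the declared residual `FloorWithScalingLimits` (stmt-QuantumFields-24873) is reduced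
to the three engine-form femto laws `FemtoEngineSigR = FBL6OscSigR ∧ CentredOscLawSigR ∧ CentredFemtoLogSigR` along a
pinned unit — statements about ONE family of centred femto cubes `[-N,N]⁴`, at the centre, with arbitrary exteriors.

* `fbl6PinnedSigR_of_osc : FBL6OscSigR → FBL6PinnedSigR` — the shared E0′ stub in reference-free oscillation form
  (one orientation) gives the registered plane-resolved boundary law along the pinned unit (spine
  `BoundaryLaw.fbl6_of_oscillation`: DLR antitonicity, translations, one coordinate permutation);
* `responseLocalisation_of_femtoEngine : FemtoEngineSigR → ResponseLocalisation` (rev 6, stmt-QuantumFields-26871) —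
  composition of the landed analysis `stub_signedOfSymKernel`, `stub_symContactOfFemto` (frs-p2),
  `symNearCovLawSigR_of_centredOsc` (g5), `fblPinnedSigR_of_fbl6` (g3);
* `runningCouplingCeiling_of_femtoEngine : FemtoEngineSigR → RunningCouplingCeiling` (stmt-QuantumFields-24275) —
  `runningCouplingCeiling_of_fbl6_femtoLog` (frs-p3) with `femtoLogSigR_of_centred` (g5);
* `nt_of_femtoEngine : FemtoEngineSigR → FloorWithScalingLimits → BalabanLadder.NT` — through the route's proved
  `Assembly` (`assembly_proof`, p616323) and the gate's `closes`.

So the route proves: **NT's clause (ii) (a signed third cumulant on a disjoint Schwartz triple, uniformly in β and the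
volume) follows from NT's clause (i) + E′-type scaling limits + the far-field ceiling (the residual) and the femto
engine interface.**  HONEST LABEL: this is a CONDITIONAL result; `FemtoEngineSigR` (Bałaban-class small-field
renormalisation group in a femto cube with prescribed exterior, for one- and two-point functions of the action density —
not in print), the residual, the cruxes, `NT` and the Yang–Mills mass gap are NOT proved here or anywhere in the tree.

Refs: route file `Theses/ForcedResponseSkewness.lean`; `Cruxes/ResponseLocalisation/Lines/signed_femto_collar.lean` (v4),
`Cruxes/RunningCouplingCeiling/Lines/pointwise_log_ceiling_r.lean` (v6); Bałaban 1989 (CMP 122) p. 356;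
Magnen–Rivasseau–Sénéor 1993 (CMP 155) pp. 325–326.
-/

set_option autoImplicit false

noncomputable section

namespace Summit.QuantumFields.YangMills.Cruxes.ResponseLocalisation.FemtoEngine

open MeasureTheory Filter Topology
open Literature.MathematicalPhysics.QuantumFieldTheory Literature.MathematicalPhysics.QuantumLattice
open Summit.QuantumFields.YangMills.Cruxes.OSLegsFromFemtoAndGap.DlrCollarTransfer
open Summit.QuantumFields.YangMills.Cruxes.ResponseLocalisation.Birth
open Summit.QuantumFields.YangMills.Cruxes.ResponseLocalisation.Femto (fblPinnedSigR_of_fbl6)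
open Summit.QuantumFields.YangMills.Cruxes.ResponseLocalisation.Signed (stub_symContactOfFemto stub_signedOfSymKernel)
open Summit.QuantumFields.YangMills.Cruxes.ResponseLocalisation.CentredOsc (symNearCovLawSigR_of_centredOsc)
open Summit.QuantumFields.YangMills.Cruxes.RunningCouplingCeiling.Pointwise
  (CentredFemtoLogSigR FemtoLogSigR runningCouplingCeiling_of_fbl6_femtoLog)
open Summit.QuantumFields.YangMills.Cruxes.RunningCouplingCeiling.CentredLog (femtoLogSigR_of_centred)
open Summit.QuantumFields.YangMills.Cruxes.NT.BoundaryLaw (fbl6_of_oscillation)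
open Summit.QuantumFields.YangMills.Theses.ForcedResponseSkewness

/-! ## The E0′ stub in oscillation form gives the registered boundary law -/

/-- **The pinned plane-resolved boundary law from its reference-free oscillation form** (one orientation, centre of
the centred femto cubes): `FBL6OscSigR → FBL6PinnedSigR`, by the spine's `BoundaryLaw.fbl6_of_oscillation` applied
along the pinned unit. [folklore] -/
theorem fbl6PinnedSigR_of_osc (h : FBL6OscSigR) : FBL6PinnedSigR := by
  intro G _ _ _ _ hG
  letI : MeasurableSpace G := borel G
  haveI : BorelSpace G := ⟨rfl⟩
  intro r a hpos hlim hpin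
  obtain ⟨D, C₁, β₁, ℓ₁, hℓ₁, H⟩ := h G hG r a hpos hlim hpin
  exact fbl6_of_oscillation G r a hpos D ⟨C₁, β₁, ℓ₁, hℓ₁, H⟩

/-- The registered E0′ stub (reference-value form) trivially gives the oscillation form (triangle inequality through
`p (0,1) β`, constant `2C₁`, threshold radius `D = 1`): the two forms are equivalent, so re-registering the stub in
oscillation form re-indexes the debt without changing it. [folklore] -/
theorem fbl6OscSigR_of_pinned (h : FBL6PinnedSigR) : FBL6OscSigR := by
  intro G _ _ _ _ hG
  letI : MeasurableSpace G := borel G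
  haveI : BorelSpace G := ⟨rfl⟩
  intro r a hpos hlim hpin
  obtain ⟨C₁, β₁, ℓ₁, p, hℓ₁, hC₁, H⟩ := h G hG r a hpos hlim hpin
  refine ⟨1, 2 * C₁, β₁, ℓ₁, hℓ₁, fun β hβ R hDR hRa η η' => ?_⟩
  -- the centre of `[-R,R]⁴` has depth `R + 1 ≥ 2`
  have hdepth : depth (fun _ => -(R : ℤ)) (2 * R + 1) 0 = R + 1 := by
    simp only [depth, Pi.zero_apply, zero_sub, neg_neg]
    have h1 : ((R : ℤ) + 1).toNat = R + 1 := by omega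
    have h2 : (-(R : ℤ) + ((2 * R + 1 : ℕ) : ℤ) - 0).toNat = R + 1 := by push_cast; omega
    simp only [h1, h2, min_self]
    exact Finset.inf'_const _ _
  have hd2 : 2 ≤ depth (fun _ => -(R : ℤ)) (2 * R + 1) 0 := by omega
  have hb : (((2 * R + 1 : ℕ) : ℕ) : ℝ) * a β ≤ ℓ₁ := by exact_mod_cast hRa
  have h01 : ((0 : Fin 4), (1 : Fin 4)).1 < ((0 : Fin 4), (1 : Fin 4)).2 := by decide
  have hη := H β hβ (fun _ => -(R : ℤ)) (2 * R + 1) hb η ((0 : Fin 4), (1 : Fin 4)) 0 h01 hd2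
  have hη' := H β hβ (fun _ => -(R : ℤ)) (2 * R + 1) hb η' ((0 : Fin 4), (1 : Fin 4)) 0 h01 hd2
  rw [hdepth] at hη hη'
  have hcast : ((R + 1 : ℕ) : ℝ) = (R : ℝ) + 1 := by push_cast; ring
  rw [hcast] at hη hη'
  have key := abs_sub_le
    (kerE G r β (fun _ => -(R : ℤ)) (2 * R + 1) η (plane G r (0, 1) 0)) (p (0, 1) β)
    (kerE G r β (fun _ => -(R : ℤ)) (2 * R + 1) η' (plane G r (0, 1) 0))
  rw [abs_sub_comm (p (0, 1) β)] at key
  have : 2 * C₁ / ((R : ℝ) + 1) ^ 4 = C₁ / ((R : ℝ) + 1) ^ 4 + C₁ / ((R : ℝ) + 1) ^ 4 := by ring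
  rw [this]
  exact key.trans (add_le_add hη hη')

/-! ## Both cruxes from the engine interface -/

/-- **The deciding crux from the engine interface**: `FemtoEngineSigR → ResponseLocalisation` (rev 6,
stmt-QuantumFields-26871) — the composition of skeleton «signed-femto-collar» v4 with its two physics stubs supplied by the
interface: `stub_signedOfSymKernel (stub_symContactOfFemto FBL SymNearCovLaw) FBL`, where `FBL` is the pinned boundary law
(`fblPinnedSigR_of_fbl6 ∘ fbl6PinnedSigR_of_osc`) and `SymNearCovLaw` comes from the centred oscillation law
(`symNearCovLawSigR_of_centredOsc`). [folklore] -/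
theorem responseLocalisation_of_femtoEngine (hE : FemtoEngineSigR) : ResponseLocalisation := by
  obtain ⟨hOsc, hCO, -⟩ := hE
  have h6 : FBL6PinnedSigR := fbl6PinnedSigR_of_osc hOsc
  have hFBL : FBLPinnedSigR := fblPinnedSigR_of_fbl6 h6
  exact stub_signedOfSymKernel (stub_symContactOfFemto hFBL (symNearCovLawSigR_of_centredOsc hFBL hCO)) hFBL

/-- **The running-coupling ceiling from the engine interface**: `FemtoEngineSigR → RunningCouplingCeiling`
(stmt-QuantumFields-24275) — skeleton «pointwise-log-ceiling-r» v6: `runningCouplingCeiling_of_fbl6_femtoLog` with the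
femto log law derived from its centred form (`femtoLogSigR_of_centred`). [folklore] -/
theorem runningCouplingCeiling_of_femtoEngine (hE : FemtoEngineSigR) : RunningCouplingCeiling := by
  obtain ⟨hOsc, -, hCL⟩ := hE
  have h6 : FBL6PinnedSigR := fbl6PinnedSigR_of_osc hOsc
  have hLog : FemtoLogSigR := femtoLogSigR_of_centred (fblPinnedSigR_of_fbl6 h6) hCL
  exact runningCouplingCeiling_of_fbl6_femtoLog h6 hLog

/-! ## The leaf, conditionally -/

/-- **The route's conditional theorem**: the femto engine interface and the declared residual
`FloorWithScalingLimits` (NT clause (i) for an L¹-normalised shrinking family + E′-type scaling limits + the far-field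
response ceiling) imply the leaf `BalabanLadder.NT` — through the proved `Assembly` (MVT / first crossing / transport,
`assembly_proof`) and the gate's deciding theorem `closes`.  CONDITIONAL: neither hypothesis is proved; the Yang–Mills
mass gap is not touched. [folklore] -/
theorem nt_of_femtoEngine (hE : FemtoEngineSigR) (hRes : FloorWithScalingLimits) :
    Summit.QuantumFields.YangMills.Theses.BalabanLadder.NT :=
  closes Summit.QuantumFields.YangMills.Theorems.ForcedResponseSkewness.assembly_proof hRes
    (runningCouplingCeiling_of_femtoEngine hE) (responseLocalisation_of_femtoEngine hE)

end Summit.QuantumFields.YangMills.Cruxes.ResponseLocalisation.FemtoEngine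

end
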